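import Summits.HubbardSuperconductivity.HubbardSuperconductivity.Theorems.AnisotropyChordTransferFibre3FamilyALemmas

/-!
# Route `AnisotropyChord` / H0 rotor rung: PartN38 — the convexity `PsiConvex` of the row profile `ψ_a` PROVED

Typed target `PsiConvex` of `…Fibre3FamilyALemmas` (PORT PartN38, theory seat `hubbard-h0-rotor-theory-1` g21, memo 21 §316):
for `0 ≤ a < 1`, `ψ_a(k) = 1/(4√((s²−a)(1+s²−a)))`, `s = sin(k/2)`, is convex on `{k ∈ (0,2π) : s² > a}`.
Proof: with `t = s² − a > 0`, `G = t(1+t)`, `q = cos²(k/2)`: `ψ' = −sin(k/2)cos(k/2)(1+2t)/(8G√G)` and the numerator of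
`ψ''` times `√G` equals `G·E` with
`E = 12 s²q(1+2t)² − 4G[(q − s²)(1+2t) + 4s²q] = 8·CERT(t,a,q)` (using `s² + q = 1`), where `CERT` is a polynomial in
`t, a, q ≥ 0` with non-negative coefficients (a Pólya-type certificate: homogenising in `t, a, q` with `t + a + q = 1` leaves
no negative coefficient); the domain is convex by concavity of `sin` on `[0, π]`; then `convexOn_of_deriv2_nonneg`.
Prover seat `hubbard-h0-rotor-p1` g23; helper for stmt-HubbardSuperconductivity-19089 (`--supports`).
-/

set_option linter.dupNamespace false
set_option autoImplicit false

noncomputable section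

namespace Summit.HubbardSuperconductivity.HubbardSuperconductivity.Theorems.AnisotropyChord.Transfer.Fibre3

/-- `G_a(k) = (sin²(k/2) − a)(1 + sin²(k/2) − a)`. [folklore] -/
def psiG (a k : ℝ) : ℝ := (Real.sin (k / 2) ^ 2 - a) * (1 + Real.sin (k / 2) ^ 2 - a)

/-- `d/dk sin²(k/2) = sin(k/2) cos(k/2)`. [folklore] -/
theorem hasDerivAt_sin_half_sq (k : ℝ) :
    HasDerivAt (fun k => Real.sin (k / 2) ^ 2) (Real.sin (k / 2) * Real.cos (k / 2)) k := by
  have h := (((hasDerivAt_id' k).div_const 2).sin).pow 2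
  refine h.congr_deriv ?_
  simp only [show (2 : ℕ) - 1 = 1 from rfl, pow_one]
  push_cast
  ring

/-- `d/dk G_a = sin(k/2)cos(k/2)(1 + 2(sin²(k/2) − a))`. [folklore] -/
theorem hasDerivAt_psiG (a k : ℝ) :
    HasDerivAt (psiG a) (Real.sin (k / 2) * Real.cos (k / 2) * (1 + 2 * (Real.sin (k / 2) ^ 2 - a))) k := by
  have h1 := (hasDerivAt_sin_half_sq k).sub_const a
  have h2 := ((hasDerivAt_sin_half_sq k).const_add 1).sub_const a
  have h := h1.mul h2
  unfold psiG
  refine h.congr_deriv ?_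
  ring

/-- the first derivative of `ψ_a`: `ψ_a' = −sin(k/2)cos(k/2)(1+2t)/(8·(G√G))`, `t = sin²(k/2) − a`. [folklore] -/
theorem hasDerivAt_psiRow (a k : ℝ) (hG : 0 < psiG a k) :
    HasDerivAt (psiRow a)
      (-(Real.sin (k / 2) * Real.cos (k / 2) * (1 + 2 * (Real.sin (k / 2) ^ 2 - a)))
        / (8 * (psiG a k * Real.sqrt (psiG a k)))) k := by
  have hr := (hasDerivAt_psiG a k).sqrt hG.ne'
  have h4 := hr.const_mul (4 : ℝ)
  have hr0 : 0 < Real.sqrt (psiG a k) := Real.sqrt_pos.mpr hG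
  have hne : 4 * Real.sqrt (psiG a k) ≠ 0 := by positivity
  have hf := (hasDerivAt_const k (1 : ℝ)).div h4 hne
  have e : psiRow a = fun k => 1 / (4 * Real.sqrt (psiG a k)) := by
    funext k; unfold psiRow psiG; rfl
  rw [e]
  refine hf.congr_deriv ?_
  set r := Real.sqrt (psiG a k) with hrdef
  have hrr : r ^ 2 = psiG a k := Real.sq_sqrt hG.le
  field_simp
  linear_combination (8 * (Real.sin (k / 2) * Real.cos (k / 2) * (1 + 2 * (Real.sin (k / 2) ^ 2 - a)))) * hrr

/-- the second derivative of `ψ_a` exists and is non-negative on the domain (`0 ≤ a`, `sin²(k/2) > a`). [folklore] -/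
theorem hasDerivAt_psiRow'_nonneg (a k : ℝ) (ha : 0 ≤ a) (ht : a < Real.sin (k / 2) ^ 2) :
    ∃ d : ℝ, HasDerivAt (fun k => -(Real.sin (k / 2) * Real.cos (k / 2) * (1 + 2 * (Real.sin (k / 2) ^ 2 - a)))
        / (8 * (psiG a k * Real.sqrt (psiG a k)))) d k ∧ 0 ≤ d := by
  have hG : 0 < psiG a k := by unfold psiG; nlinarith
  have hσ' : HasDerivAt (fun k : ℝ => Real.sin (k / 2)) (Real.cos (k / 2) * (1 / 2)) k :=
    ((hasDerivAt_id' k).div_const 2).sin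
  have hγ' : HasDerivAt (fun k : ℝ => Real.cos (k / 2)) (-Real.sin (k / 2) * (1 / 2)) k :=
    ((hasDerivAt_id' k).div_const 2).cos
  have h12t : HasDerivAt (fun k : ℝ => 1 + 2 * (Real.sin (k / 2) ^ 2 - a))
      (0 + 2 * (Real.sin (k / 2) * Real.cos (k / 2))) k :=
    (hasDerivAt_const k (1 : ℝ)).add (((hasDerivAt_sin_half_sq k).sub_const a).const_mul 2)
  have hN := ((hσ'.mul hγ').mul h12t).neg
  have hGd := hasDerivAt_psiG a k
  have hr := hGd.sqrt hG.ne'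
  have hM := (hGd.mul hr).const_mul (8 : ℝ)
  have hr0 : 0 < Real.sqrt (psiG a k) := Real.sqrt_pos.mpr hG
  have hMne : 8 * (psiG a k * Real.sqrt (psiG a k)) ≠ 0 := by positivity
  have hdiv := hN.div hM hMne
  refine ⟨_, hdiv, ?_⟩
  apply div_nonneg _ (sq_nonneg _)
  simp only [Pi.mul_apply, Pi.neg_apply]
  set σ := Real.sin (k / 2) with hσ
  set γ := Real.cos (k / 2) with hγ
  set r := Real.sqrt (psiG a k) with hrdef
  have hGdef : psiG a k = (σ ^ 2 - a) * (1 + σ ^ 2 - a) := rfl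
  have hrr : r ^ 2 = psiG a k := Real.sq_sqrt hG.le
  rw [hGdef] at hrr hMne ⊢
  have key : -((γ * (1 / 2) * γ + σ * (-σ * (1 / 2))) * (1 + 2 * (σ ^ 2 - a)) + σ * γ * (0 + 2 * (σ * γ))) *
        (8 * ((σ ^ 2 - a) * (1 + σ ^ 2 - a) * r)) -
      -(σ * γ * (1 + 2 * (σ ^ 2 - a))) *
        (8 * (σ * γ * (1 + 2 * (σ ^ 2 - a)) * r +
            (σ ^ 2 - a) * (1 + σ ^ 2 - a) * (σ * γ * (1 + 2 * (σ ^ 2 - a)) / (2 * r))))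
      = ((σ ^ 2 - a) * (1 + σ ^ 2 - a)) * (12 * σ ^ 2 * γ ^ 2 * (1 + 2 * (σ ^ 2 - a)) ^ 2
          - 4 * ((σ ^ 2 - a) * (1 + σ ^ 2 - a)) * ((γ ^ 2 - σ ^ 2) * (1 + 2 * (σ ^ 2 - a)) + 4 * σ ^ 2 * γ ^ 2)) / r := by
    field_simp
    linear_combination (8 * (-((σ ^ 2 - a) * (1 + σ ^ 2 - a)) * ((γ ^ 2 - σ ^ 2) * (1 + 2 * (σ ^ 2 - a)) + 4 * σ ^ 2 * γ ^ 2)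
      + 2 * σ ^ 2 * γ ^ 2 * (1 + 2 * (σ ^ 2 - a)) ^ 2)) * hrr
  rw [key]
  -- the Pólya-type certificate: `E = 8·CERT(t, a, q)` with `t = σ² − a`, `q = γ² = 1 − σ²`
  have hsc : σ ^ 2 + γ ^ 2 = 1 := Real.sin_sq_add_cos_sq (k / 2)
  set t := σ ^ 2 - a with htdef
  have ht0 : 0 ≤ t := by rw [htdef]; linarith
  have hq0 : 0 ≤ γ ^ 2 := sq_nonneg γ
  have hE : 12 * σ ^ 2 * γ ^ 2 * (1 + 2 * t) ^ 2
        - 4 * (t * (1 + σ ^ 2 - a)) * ((γ ^ 2 - σ ^ 2) * (1 + 2 * t) + 4 * σ ^ 2 * γ ^ 2)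
      = 8 * (3 / 2 * a * (γ ^ 2) ^ 3 + 3 * a ^ 2 * (γ ^ 2) ^ 2 + 3 / 2 * a ^ 3 * γ ^ 2 + t * (γ ^ 2) ^ 3
          + 19 / 2 * t * a * (γ ^ 2) ^ 2 + 9 * t * a ^ 2 * γ ^ 2 + 1 / 2 * t * a ^ 3 + 5 * t ^ 2 * (γ ^ 2) ^ 2
          + 35 / 2 * t ^ 2 * a * γ ^ 2 + 3 * t ^ 2 * a ^ 2 + 9 * t ^ 3 * γ ^ 2 + 11 / 2 * t ^ 3 * a + 3 * t ^ 4) := by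
    rw [htdef]
    linear_combination (-4 * γ ^ 2 * a + 12 * γ ^ 2 * a ^ 2 - 4 * γ ^ 4 * a + 4 * σ ^ 2 * a - 12 * σ ^ 2 * a ^ 2
      - 8 * σ ^ 2 * γ ^ 2 + 8 * σ ^ 2 * γ ^ 2 * a - 8 * σ ^ 2 * γ ^ 4 - 4 * σ ^ 4 + 28 * σ ^ 4 * a
      - 32 * σ ^ 4 * γ ^ 2 - 16 * σ ^ 6) * hsc
  set q := γ ^ 2 with hqdef
  have hCERT : 0 ≤ 3 / 2 * a * q ^ 3 + 3 * a ^ 2 * q ^ 2 + 3 / 2 * a ^ 3 * q + t * q ^ 3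
          + 19 / 2 * t * a * q ^ 2 + 9 * t * a ^ 2 * q + 1 / 2 * t * a ^ 3 + 5 * t ^ 2 * q ^ 2
          + 35 / 2 * t ^ 2 * a * q + 3 * t ^ 2 * a ^ 2 + 9 * t ^ 3 * q + 11 / 2 * t ^ 3 * a + 3 * t ^ 4 := by
    have c1 := mul_nonneg ha (pow_nonneg hq0 3)
    have c2 := mul_nonneg (pow_nonneg ha 2) (pow_nonneg hq0 2)
    have c3 := mul_nonneg (pow_nonneg ha 3) hq0
    have c4 := mul_nonneg ht0 (pow_nonneg hq0 3)
    have c5 := mul_nonneg (mul_nonneg ht0 ha) (pow_nonneg hq0 2)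
    have c6 := mul_nonneg (mul_nonneg ht0 (pow_nonneg ha 2)) hq0
    have c7 := mul_nonneg ht0 (pow_nonneg ha 3)
    have c8 := mul_nonneg (pow_nonneg ht0 2) (pow_nonneg hq0 2)
    have c9 := mul_nonneg (mul_nonneg (pow_nonneg ht0 2) ha) hq0
    have c10 := mul_nonneg (pow_nonneg ht0 2) (pow_nonneg ha 2)
    have c11 := mul_nonneg (pow_nonneg ht0 3) hq0
    have c12 := mul_nonneg (pow_nonneg ht0 3) ha
    have c13 := pow_nonneg ht0 4
    linarith
  have hGt : (σ ^ 2 - a) * (1 + σ ^ 2 - a) = t * (1 + σ ^ 2 - a) := by rw [htdef]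
  rw [hGt, hE]
  apply div_nonneg _ hr0.le
  apply mul_nonneg _ (by linarith)
  apply mul_nonneg ht0 (by linarith)


/-- the domain `{k ∈ (0, 2π) : sin²(k/2) > a}` is convex (concavity of `sin` on `[0, π]`). [folklore] -/
theorem convex_psiDomain (a : ℝ) :
    Convex ℝ {k : ℝ | 0 < k ∧ k < 2 * Real.pi ∧ a < Real.sin (k / 2) ^ 2} := by
  intro x hx y hy μ ν hμ hν hμν
  obtain ⟨hx0, hx2, hxa⟩ := hx
  obtain ⟨hy0, hy2, hya⟩ := hy
  simp only [smul_eq_mul, Set.mem_setOf_eq]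
  have hsx : 0 < Real.sin (x / 2) := Real.sin_pos_of_pos_of_lt_pi (by linarith) (by linarith)
  have hsy : 0 < Real.sin (y / 2) := Real.sin_pos_of_pos_of_lt_pi (by linarith) (by linarith)
  set m := min (Real.sin (x / 2)) (Real.sin (y / 2)) with hm
  have hm0 : 0 < m := lt_min hsx hsy
  have hma : a < m ^ 2 := by
    rcases min_choice (Real.sin (x / 2)) (Real.sin (y / 2)) with h | h <;> rw [hm, h] <;> assumption
  refine ⟨?_, ?_, ?_⟩
  · have h1 : μ * x + ν * y ≥ μ * (min x y) + ν * (min x y) :=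
      add_le_add (mul_le_mul_of_nonneg_left (min_le_left x y) hμ) (mul_le_mul_of_nonneg_left (min_le_right x y) hν)
    have h2 : 0 < min x y := lt_min hx0 hy0
    nlinarith
  · have h1 : μ * x + ν * y ≤ μ * (max x y) + ν * (max x y) :=
      add_le_add (mul_le_mul_of_nonneg_left (le_max_left x y) hμ) (mul_le_mul_of_nonneg_left (le_max_right x y) hν)
    have h2 : max x y < 2 * Real.pi := max_lt hx2 hy2
    nlinarith
  · have hconc := strictConcaveOn_sin_Icc.concaveOn.2
      (Set.mem_Icc.2 ⟨by linarith, by linarith⟩ : x / 2 ∈ Set.Icc 0 Real.pi)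
      (Set.mem_Icc.2 ⟨by linarith, by linarith⟩ : y / 2 ∈ Set.Icc 0 Real.pi) hμ hν hμν
    simp only [smul_eq_mul] at hconc
    have e : μ * (x / 2) + ν * (y / 2) = (μ * x + ν * y) / 2 := by ring
    rw [e] at hconc
    have hlow : m ≤ μ * Real.sin (x / 2) + ν * Real.sin (y / 2) := by
      have := add_le_add (mul_le_mul_of_nonneg_left (min_le_left (Real.sin (x / 2)) (Real.sin (y / 2))) hμ)
        (mul_le_mul_of_nonneg_left (min_le_right (Real.sin (x / 2)) (Real.sin (y / 2))) hν)
      rw [← hm] at this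
      nlinarith
    have hs : m ≤ Real.sin ((μ * x + ν * y) / 2) := hlow.trans hconc
    nlinarith [hm0]

/-- the domain is open. [folklore] -/
theorem isOpen_psiDomain (a : ℝ) : IsOpen {k : ℝ | 0 < k ∧ k < 2 * Real.pi ∧ a < Real.sin (k / 2) ^ 2} := by
  have e : {k : ℝ | 0 < k ∧ k < 2 * Real.pi ∧ a < Real.sin (k / 2) ^ 2}
      = Set.Ioi 0 ∩ (Set.Iio (2 * Real.pi) ∩ {k : ℝ | a < Real.sin (k / 2) ^ 2}) := by
    ext k; simp [Set.mem_Ioi, Set.mem_Iio]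
  rw [e]
  refine isOpen_Ioi.inter (isOpen_Iio.inter ?_)
  exact isOpen_lt continuous_const (by fun_prop)

/-- ★ **`PsiConvex` holds.** [folklore] -/
theorem psiConvex_holds : PsiConvex := by
  intro a ha0 _ha1
  set D := {k : ℝ | 0 < k ∧ k < 2 * Real.pi ∧ a < Real.sin (k / 2) ^ 2} with hDdef
  have hDo : IsOpen D := isOpen_psiDomain a
  have hG : ∀ k ∈ D, 0 < psiG a k := by
    intro k hk
    obtain ⟨-, -, hka⟩ := hk
    unfold psiG
    exact mul_pos (by linarith) (by linarith)
  have hd1 : ∀ k ∈ D, HasDerivAt (psiRow a)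
      (-(Real.sin (k / 2) * Real.cos (k / 2) * (1 + 2 * (Real.sin (k / 2) ^ 2 - a)))
        / (8 * (psiG a k * Real.sqrt (psiG a k)))) k :=
    fun k hk => hasDerivAt_psiRow a k (hG k hk)
  have heq : ∀ k ∈ D, deriv (psiRow a) =ᶠ[nhds k]
      (fun k => -(Real.sin (k / 2) * Real.cos (k / 2) * (1 + 2 * (Real.sin (k / 2) ^ 2 - a)))
        / (8 * (psiG a k * Real.sqrt (psiG a k)))) :=
    fun k hk => Filter.eventuallyEq_of_mem (hDo.mem_nhds hk) (fun v hv => (hd1 v hv).deriv)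
  refine convexOn_of_deriv2_nonneg (convex_psiDomain a) ?_ ?_ ?_ ?_
  · exact fun k hk => (hd1 k hk).continuousAt.continuousWithinAt
  · rw [hDo.interior_eq]; exact fun k hk => (hd1 k hk).differentiableAt.differentiableWithinAt
  · rw [hDo.interior_eq]; intro k hk
    obtain ⟨d, hd, -⟩ := hasDerivAt_psiRow'_nonneg a k ha0 hk.2.2
    exact (hd.differentiableAt.congr_of_eventuallyEq (heq k hk)).differentiableWithinAt
  · rw [hDo.interior_eq]; intro k hk
    obtain ⟨d, hd, hnn⟩ := hasDerivAt_psiRow'_nonneg a k ha0 hk.2.2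
    show 0 ≤ deriv (deriv _) k
    rw [(heq k hk).deriv_eq, hd.deriv]
    exact hnn

end Summit.HubbardSuperconductivity.HubbardSuperconductivity.Theorems.AnisotropyChord.Transfer.Fibre3

end
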